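import Mathlib
import HarnessLib
import HarnessLib.Audit
import Summits.PneNP.Statement
import Literature.Computability.Complexity.BoolEncodings
import HarnessLib.Audit.Status.Attr

/-!
Route: EcdlpDefinability

DORMANT since 2026-08-22T10:33:10Z (reconciler: no traction for 5.3 d (last activity item-evidence-added at 2026-08-17T03:14:00Z); parked, not closed — `ledger route dormant route-PneNP-EcdlpDefinability --off` to reactivate) — unstaffed, not closed; items shared with open routes are served there. `ledger route dormant <id> --off` reactivates.

# Route PneNP/EcdlpDefinability — "first-order logic cannot see the discrete logarithm: ECDLP over
prime fields is not in P" (realises idea card PneNP/PneNP/definable-genericity-elliptic-curves,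
corrected)

## Thesis X (it suffices to show)
Words: the elliptic-curve discrete-logarithm language over prime fields — binary encodings
(Literature `encodingListNatBool`) of tuples (p, a₁, a₂, a₃, a₄, a₆, x_P, y_P, x_Q, y_Q, t) with p
prime, W = [a₁,a₂,a₃,a₄,a₆] a Weierstrass curve over 𝔽_p with Δ ≠ 0, P, Q affine points of W(𝔽_p)
and some m ≤ t with mP = Q (Mathlib's group law on `WeierstrassCurve.Affine.Point`) — is decided by
no deterministic polynomial-time Turing machine (Cook/Clay class `PNPWave0.P Bool`). Binary search
on t makes X equivalent to "no polynomial-time algorithm computes prime-field elliptic discrete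
logarithms" (Miller 1985 [Miller1986ECC]; the uniform, worst-case shadow of Miller's conjecture that
prime-field curves are generic groups [KoblitzMenezes2007]).
Lean (decl `EcdlpNotInP`): `Literature.Computability.Complexity.encodingListNatBool.toLanguage {l :
List ℕ | ∃ (p a₁ a₂ a₃ a₄ a₆ xp yp xq yq t : ℕ), l = [p, a₁, a₂, a₃, a₄, a₆, xp, yp, xq, yq, t] ∧ ∃
hp : p.Prime, (haveI : Fact p.Prime := ⟨hp⟩; ∃ hP hQ, W.Δ ≠ 0 ∧ ∃ m ≤ t, m • Point.some xp yp hP =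
Point.some xq yq hQ)} ∉ Literature.Computability.Complexity.PNPWave0.P Bool` (W = ⟨a₁,…,a₆⟩ over
ZMod p; full term in the route file).

## Assembly X → PneNP (decl `Assembly`)
`EcdlpInNP → EcdlpNotInP → PneNP`: the same language is in `PNPWave0.NP Bool` (certificate m;
primality, curve arithmetic and double-and-add are polynomial time) and `PneNP = ∃ L ∈ NP Bool, L ∉
P Bool`, so the assembly is `fun hNP hP => ⟨_, hNP, hP⟩` (checked in the planner's Sketch.lean). No
bridges, no completeness, no cryptographic reduction: L_EC ∈ NP ∩ coNP, so only DIRECT lower bounds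
can reach X — the cruxes are rungs of a restricted-model ladder below X (bounded-degree polynomials
⊂ bounded first-order formulas with quantifiers and parameters ⊂ formulas with short-interval
predicates ⊂ … ⊂ P), each a precise statement of "this much mathematics provably cannot read the
logarithm off E(𝔽_p)".

Rationale: WHY THIS LINE (widen: model theory of pseudofinite fields + exponential sums on curves, brought to
bear on an explicit NP ∩ coNP problem). Next to Lattice (GapSVP) and MetaCplx/Ktlang (K^t),
prime-field ECDLP is the third "explicit hard function" thesis and the one whose believed hardness
is EXPONENTIAL (√p, Shoup's generic bound [Shoup1997]) with a forty-year record of failed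
structure-finding (no index calculus over 𝔽_p: [Miller1986ECC], [KoblitzMenezes2007], lifting
obstructions [Silverman2009LiftingECDLP], summation polynomials without gain
[Semaev2004SummationPolynomials], [PetitKostersMesseng2016]). The card's engine is imported whole:
Chatzidakis–van den Dries–Macintyre counting of definable sets
[ChatzidakisVanDenDriesMacintyre1992], Kowalski's "black-boxing of Deligne" for sums over definable
sets [Kowalski2007, Thm 1-3 and the geometric decomposition Thm 8], Kohel–Shparlinski bounds for
character sums along E(𝔽_p) [KohelShparlinski2000], and the Shparlinski-school interpolation lower
bounds [LangeWinterhof2002] as the elementary base of the ladder.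
PLANNER'S CORRECTION OF THE CARD (recorded so nobody re-files it). The card's crux #3 — "Shoup's
Ω(p^{1/2}) survives relative to bounded-complexity ring-definable DECISION oracles with parameters"
— is false in every information-theoretic query model: with the single formula φ(x;c) := ∃z (z·z = x
+ c) and 3·log₂ p uniformly random explicit shifts c, the answer bits determine the x-coordinate of
a hidden point with probability ≥ 1 − 1/p (two candidates agree on one shift with probability ≤ 1/2
+ 1/p because Σ_c η((c+u)(c+u')) = −1; support item LegendreFingerprint is the typed lemma), using
ZERO group operations; a computationally unbounded generic adversary then reads the logarithm
offline. The same fingerprint collapses black-box-field models over a known prime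
([BonehLipton1996], [MaurerRaub2007] for the phenomenon). Hence: no oracle-genericity item, and no
separate `Capture` item — once genericity must be computational, "capture" is Miller's conjecture in
uniform form, i.e. X itself up to the NP-membership glue, and filing it would restate the target
(D-0019). What survives, and is the route: definability lower bounds for the logarithm as a
FUNCTION/RELATION of bounded complexity — decoding a fingerprint is exactly what a bounded formula
cannot do.
RANKED CRUXES (all typed, elaborated rc=0 in Sketch.lean):
#2 DefinableSizeDichotomy — the classical fact the line rests on (CDM 1992 Main Theorem, corollary):
a ring formula of FIXED complexity defines, in 𝔽_p^m with arbitrary parameters, a set of size ≤ C or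
≥ δ·p — "first-order logic cannot see a factor base" (index calculus needs |F| = p^α, 0<α<1). Known
in print, absent from Literature/Mathlib (needs Lang–Weil/RH for curves:
`FunctionFieldZeta.hasseWeil` is a named fact, `hasse_bound_holds` is proved); filed FIRST per the
plancard rule so the dependency is explicit; re-file as support `(h : CDM) →` once a named fact
lands (cite item filed).
#3 DefinableLogBound — the route's theorem-candidate (new combination): for every ring formula
φ(u,x,y;c̄) and ε>0 there is C with: on every elliptic W/𝔽_p, every P, every parameter choice, φ
picks out the logarithm (u = t uniquely from (x,y)(tP)) for at most C·p^{1/2+ε} values t < ord P.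
Proof plan: Kowalski's decomposition (definable graph ⊆ images of bounded-degree curves Z → E × 𝔸¹
with ≤ e-element fibres) + Deligne/Kohel–Shparlinski for Σ_{(R,u)∈Z} χ(R)ψ(hu) with Lang-torsor
characters χ of E(𝔽_p) (H²_c vanishes unless u is constant on a component, by comparing ramification
of L_ψ(hu) at poles of u with the everywhere-unramified pull-back of L_χ) + completion of the
archimedean cut-off t < N (log p). Covers anomalous and pairing-friendly curves consistently:
Semaev–Smart–Satoh–Araki and MOV use Miller-type straight-line programs of length Θ(log p), outside
bounded complexity.
#4 IntervalPointSetEnergy — the ORDER tier in its primitive form: the set D_I of affine points with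
x-coordinate in an interval of length p^θ has additive energy E₂(D_I) ≤ C(p^{3θ−η} + p^{4θ−1}) in
the group W(𝔽_p): "short intervals are not approximate subgroups of an elliptic curve". θ > 1/2
follows from completion + Kohel–Shparlinski; θ ≤ 1/2 is the Pólya–Vinogradov/Burgess frontier for
curves (sum–product on elliptic curves [Shparlinski2008SumProductEC], [AhmadiShparlinski2010] stop
at √p) and is exactly Semaev's small-coordinate regime; over 𝔽_p^* the analogous
multiplicative-energy bound is proved by LIFTING TO ℤ — the move that index calculus uses there and
that heights forbid on curves (the card's T3), so the order and lifting tiers meet in this one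
statement.
SUPPORT: EcdlpInNP (assembly glue; TM2 work with the Literature FP toolkit),
PolynomialLogDegreeBound (Lange–Winterhof rung, Lean-feasible now: x(2R) = φ₂/ψ₂² has poles at
2-torsion, so F∘r − 2F ≠ 0 has ≤ 4·deg F relevant roots), LegendreFingerprint (the dead-end lemma
above; elementary).
KILL CRITERIA: ¬X (prime-field ECDLP ∈ P) closes the route and elliptic-curve cryptography with it.
An explicit bounded formula reading ≫ p^{1/2+ε} logarithms (¬#3) is a new non-generic ECDLP
resource: route BROKEN, repair only by explaining the resource as a new tier. ¬#4 (interval sets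
with near-maximal energy) hands Semaev-type decompositions free relations: Miller's heuristic dies
for prime fields; X survives formally but the route's rationale does not — close as
refuted:IntervalPointSetEnergy unless θ-range restatement is principled. ¬#2 cannot happen for fixed
φ (CDM); a refutation means the item is mis-typed — restate.
DELIBERATELY NOT DECOMPOSED: the lifting tier T3 (Silverman's four lifting problems are theorems;
Néron–Tate heights are not in Mathlib); the growing-complexity rung "formulas with ≤ ε·log p symbols
read ≤ p^{1−ε'} logs" (the honest next rung towards P — at Θ(log p) symbols the graph of t ↦ tP is
Σ₁-definable by double-and-add, so the definability ladder has exactly this one more rung; needs a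
formula-size notion, to be requested when #3 moves); k ≥ 3 energies (Semaev's p^{1/k} boxes); the
average-case/OWF form of X (joins MetaCplx); sup-norm short-interval character sums (a sibling of
#4, not a separate crux).

Novelty: Nearest prior art: (i) [LangeWinterhof2002] (doi:10.1007/3-540-45655-4_16; AAECC 2003
doi:10.1007/3-540-44828-4_7) and Shparlinski's interpolation programme — degree/sparsity lower
bounds for POLYNOMIALS representing the EC discrete log or Diffie–Hellman map on large sets (our
support item PolynomialLogDegreeBound is their rung); (ii) [Kowalski2007] — Deligne black-boxed over
CDM-definable sets, for field characters; (iii) [KohelShparlinski2000] — character sums over E(𝔽_q)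
with additive characters of coordinate functions; (iv) [Shoup1997]/[MaurerWolf1998]/aux-input
generic bounds [CorriganGibbsKogan2018] — unstructured advice, bit-counting; (v)
[Shparlinski2008SumProductEC] / [AhmadiShparlinski2010] — sum–product phenomena for point sets on
curves above √p.
Delta: crux DefinableLogBound joins (i)+(ii)+(iii): it replaces "polynomial of degree d" by "any
first-order ring formula of fixed complexity, with quantifiers (guessing) and arbitrary parameters",
which no interpolation bound covers and which needs Lang-torsor characters that Kowalski's theorems
do not state; crux IntervalPointSetEnergy states the order-tier obstruction to Semaev's prime-field
index calculus as an additive-energy bound for interval point sets, below the √p range where (v)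
stops; and the route CORRECTS its own card: the printed-looking "Shoup relative to definable
oracles" is shown vacuous by Legendre fingerprinting (support LegendreFingerprint), so genericity is
recast as definability of the log function  [refs: 10.1007/3-540-45655-4_16, 10.1007/3-540-44828-4_7, 10.1007/3-540-68697-5_22, 10.1007/978-3-540-76900-2_26, 10.1016/j.ffa.2007.12.002, 10.1017/s0013091508000771, 10.1142/9789812793430_0006, 10.1007/s11856-007-0062-2, 10.1007/10722028_24, 10.1007/bfb0054118, 10.1007/978-3-319-78375-8_14, math/0504316, doi:10.1007/3-540-45655-4_16, doi:10.1007/3-540-44828-4_7, doi:10.1007/3-540-68697-5_22, doi:10.100]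

Barriers (technique_class: definability, exponential-sums, generic-group-model): - Literature.Barriers.PneNP.Relativization: applies by inheritance to X (ECDLP ∉ P ⇒ P ≠ NP needs a
non-relativizing step) and, sharper, to the card's original plan: the generic-group model IS an
oracle model and the planner's Legendre-fingerprint observation shows that enriching the oracle with
any intermediate-density definable predicate makes it information-theoretically trivial — so no
relativized/generic lower bound is claimed at all; the cruxes are lower bounds against explicit
SYNTACTIC classes (bounded first-order formulas, interval predicates, bounded-degree polynomials)
over the explicit curve, which do not relativize, and the gap to P is conceded, not bridged.
- Literature.Barriers.PneNP.RelativizationNarrow: same answer; nothing here is an oracle-independent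
simulation/diagonalization argument.
- Literature.Barriers.PneNP.BoundedRelativization: same answer; no PSPACE-relativizing technique is
invoked, the route proves nothing about general polynomial-time machines.
- Literature.Barriers.PneNP.Algebrization: low-degree extension of an oracle is a special case of
ring-definable structure of UNBOUNDED degree; the route's definability tier is bounded complexity,
where CDM/Kowalski give structure, and it makes no claim in the algebrizing regime (degree growing
with p) — that is precisely the "growing-complexity rung" left undecomposed; Aaronson–Wigderson's
collapses use PSPACE-complete oracles, not curve groups, so they neither help nor block.
- Literature.Barriers.Pne

Novelty grade: new-combination — ROUTE REVIEW (refuter 2026-08-15). All 8 decls rc0, no junk (binary encodingListNatBool; real exponents); Assembly proved sorry-free (evidence on stmt-PneNP-2078). Items stamped with briefings: 2071 genuine conjecture (+2075 ⇒ P≠NP); 2072 TRUE (CDM corollary; in-tree named fact + proved reduction; a (refuter refuter-rreview-route-PneNP-EcdlpDefinab-f574c8f2-0, 2026-08-15T13:59:47Z; prior: Kowalski2007 doi:10.1007/s11856-007-0062-2, KohelShparlinski2000 doi:10.1007/10722028_24, LangeWinterhof2002 doi:10.1007/3-540-45655-4_16, CDM1992 doi:10.1515/crll.1992.427.107, MeletiouStamatiouTsiakalos2011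 doi:10.1007/978-3-642-23141-4_17)

History (route lifecycle, newest last):
- 2026-08-16T04:14:01Z · AUTO-CRUX (backfill): EcdlpNotInP — hypotheses of the deciding theorem that nothing in the route derives are cruxes (operator:999:1085951)
- 2026-08-22T10:33:10Z · DORMANT — reconciler: no traction for 5.3 d (last activity item-evidence-added at 2026-08-17T03:14:00Z); parked, not closed — `ledger route dormant route-PneNP-EcdlpDefin (operator:999:3865407)

sub-problem: PneNP · status: dormant · opened planner-plancard-PneNP-PneNP-definable-generi-c142c150-0 2026-08-15T11:00:32Z · rev 2 · ledger route-PneNP-EcdlpDefinability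
GENERATED by the gate from the ledger (D-0016/17). Provers cite these decls: `theorem foo : Summit.PneNP.PneNP.Theses.EcdlpDefinability.<Decl> := …` in Summits/PneNP/PneNP/Theorems/<Name>.lean.
-/

namespace Summit.PneNP.PneNP.Theses.EcdlpDefinability

open scoped BigOperators Topology Manifold Classical MeasureTheory ProbabilityTheory Matrix InnerProductSpace ComplexConjugate ContinuousMap
open Filter Set Function TopologicalSpace MeasureTheory

attribute [summit_statement] _root_.PneNP

open Literature.PNP

/-- item stmt-PneNP-2071 · crux (kind.auto-crux: conjecture-grade) · rank 0 · open · by planner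
why it might fail: Prime-field ECDLP may simply be in P: L_EC ∈ NP ∩ coNP (given ord P), so there is no NP-hardness backstop and an algorithm would contradict nothing proved; all evidence is restricted-model (Shoup's generic Ω(√p), interpolation-degree bounds) plus 40 years of failed index calculus.
sources: Miller1986ECC, Shoup1997 (Thm 1: Ω(√q) generic lower bound), KoblitzMenezes2007, Silverman2009LiftingECDLP, Semaev2004SummationPolynomials, PetitKostersMesseng2016
[target] Thesis X: the prime-field elliptic-curve discrete-logarithm language L_EC (encodings of (p,
a1,a2,a3,a4,a6, xP,yP, xQ,yQ, t) with p prime, Delta(W) != 0, P,Q affine on W(F_p), and some m <= t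
with mP = Q) is not in Cook's class P over {0,1}. Equivalent by binary search on t to: no
deterministic polynomial-time algorithm computes prime-field elliptic discrete logs (Miller 1985).
Worst-case and uniform, hence the weakest natural hardness statement about ECDLP; the √p generic
bound (Shoup 1997) and Miller's genericity heuristic (Koblitz–Menezes 2007) are the evidence, not
ingredients. -/
@[route_item "route-PneNP-EcdlpDefinability", crux]
def EcdlpNotInP : Prop :=
  Literature.Computability.Complexity.encodingListNatBool.toLanguage {l : List ℕ | ∃ (p a₁ a₂ a₃ a₄ a₆ xp yp xq yq t : ℕ), l = [p, a₁, a₂, a₃, a₄, a₆, xp, yp, xq, yq, t] ∧ ∃ hp : p.Prime, (haveI : Fact p.Prime := ⟨hp⟩; ∃ (hP : (⟨(a₁ : ZMod p), (a₂ : ZMod p), (a₃ : ZMod p), (a₄ : ZMod p), (a₆ : ZMod p)⟩ : WeierstrassCurve (ZMod p)).toAffine.Nonsingular (xp : ZMod p) (yp : ZMod p)) (hQ : (⟨(a₁ : ZMod p), (a₂ : ZMod p), (a₃ : ZMod p), (a₄ : ZMod p), (a₆ : ZMod p)⟩ : WeierstrassCurve (ZMod p)).toAffine.Nonsingular (xq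 : ZMod p) (yq : ZMod p)), (⟨(a₁ : ZMod p), (a₂ : ZMod p), (a₃ : ZMod p), (a₄ : ZMod p), (a₆ : ZMod p)⟩ : WeierstrassCurve (ZMod p)).Δ ≠ 0 ∧ ∃ m : ℕ, m ≤ t ∧ m • WeierstrassCurve.Affine.Point.some (xp : ZMod p) (yp : ZMod p) hP = WeierstrassCurve.Affine.Point.some (xq : ZMod p) (yq : ZMod p) hQ)} ∉ Literature.Computability.Complexity.PNPWave0.P Bool

/-- item stmt-PneNP-2073 · crux · rank 3 · open · by planner
why it might fail: Unproved: needs square-root cancellation, uniform in p, W, P, c̄, for Lang-torsor characters of E(F_p) twisted by ψ(u) along every bounded-degree curve Z⊂E×A¹ of the CDM/Kowalski decomposition (bounded fibres, exceptional components); a bounded formula reading ≫p^{1/2+ε} logs (e.g. N=p) refutes it.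
sources: Kowalski2007 Thm 1–3, Thm 8 (decomposition), Cor. 13 (arXiv:math/0504316, read), KohelShparlinski2000 Thm 1, Cor. 1 (= Literature.NumberTheory.EllipticCurves.KohelShparlinski.CoordinateCharSumBound, named fact in tree: covers only f = x, y — the simplest instance φ := (u = x), giving O(√p·log p)), LangeWinterhof2002 (doi:10.1007/3-540-45655-4_16: the quantifier-free polynomial special case), Deligne1980, ChatzidakisVanDenDriesMacintyre1992, searched 2026-08-15 (crossref/arXiv/zbMATH: 'definable discrete logarithm', 'polynomial interpolation elliptic curve discrete logarithm', 'exponential sums definable sets'): no definability-class lower bound for EC logs in print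
[crux] The route's T1 theorem-candidate ('first-order logic cannot see the discrete logarithm'): for
every ring formula φ(u, x, y; c̄) and ε > 0 there is C such that for every prime p, every elliptic
W/F_p, every point P and all parameters c̄ ∈ F_p^n, φ computes the logarithm (φ(t̄, x(tP), y(tP),
c̄) holds with t̄ the unique such u) for at most C·p^{1/2+ε} values t < ord P. The class is closed
under Boolean operations and quantifiers (guessing field witnesses) and contains all fixed-degree
rational functions with parameters (Lange–Winterhof's setting) and fixed-depth algebraic decision
procedures; the Legendre fingerprint (support item) is no counterexample since decoding it is not
bounded-definable. Proof plan (rationale): Kowalski 2007 Thm 8 decomposition after CDM →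
bounded-degree curves Z → E × A¹; completion of the cut-off t < N (log p); Deligne for Σ_{(R,u)∈Z}
χ(R)ψ(hu) with Lang-torsor characters χ of E(F_p) (H²_c = 0 unless u is constant on a component, by
ramification). Consistent on anomalous/pairing-friendly curves: their attacks are Θ(log p)-length
straight-line programs. New combination: Kowalski ⊕ Kohel–Shparlinski ⊕ Lange–Winterhof. -/
@[route_item "route-PneNP-EcdlpDefinability"]
def DefinableLogBound : Prop :=
  ∀ (n : ℕ) (φ : FirstOrder.Language.ring.Formula (Fin 3 ⊕ Fin n)) (ε : ℝ), 0 < ε → ∃ C : ℝ, ∀ (p : ℕ) [Fact p.Prime] (W : WeierstrassCurve (ZMod p)) [W.IsElliptic] (P : W.toAffine.Point) (c : Fin n → ZMod p), (letI := FirstOrder.Ring.compatibleRingOfRing (ZMod p); (((Finset.range (addOrderOf P)).filter fun t : ℕ => ∃ (x y : ZMod p) (h : W.toAffine.Nonsingular x y), t • P = WeierstrassCurve.Affine.Point.some x y h ∧ φ.Realize (Sum.elim ![(t : ZMod p), x, y] c) ∧ ∀ u : ZMod p, φ.Realize (Sum.elim ![u, x, y] c) → u = (t : ZMod p)).card : ℝ)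 ≤ C * (p : ℝ) ^ (1 / 2 + ε))

/-- item stmt-PneNP-2074 · crux · rank 4 · open · by planner
why it might fail: Open for p^c<p^θ≤√p: completion+Kohel–Shparlinski gives E₂ ≤ p^{4θ−1}+p^{1+θ+o(1)}, nontrivial iff θ>1/2; small-box lifting/Bombieri–Pila (arXiv:1111.1543, M<p^{1/3}) covers only tiny θ on a fixed curve; a CM/supersingular family with additively structured short-x point sets would falsify it.
sources: KohelShparlinski2000 Cor. 1 (= Literature.NumberTheory.EllipticCurves.KohelShparlinski.CoordinateCharSumBound; yields the θ > 1/2 range by completion), Shparlinski2008SumProductEC (doi:10.1016/j.ffa.2007.12.002: elliptic sum–product above √p), AhmadiShparlinski2010 (doi:10.1017/s0013091508000771), arXiv:1111.1543 = doi:10.1307/mmj/1409932631 (Chang–Cilleruelo–Garaev–Hernández–Shparlinski–Zumalacárregui 2014, Thms 1–2, Cor. 3: points on y² ≡ f(x) mod p in small boxes, nontrivial for M < p^{1/3−ε}; read pp.2–5), BombieriPila1989, Semaev2004SummationPolynomials (the small-coordinate regime this obstructs)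
[crux] The ORDER tier (card's T2) in primitive form: for θ ∈ (0,1) there are η > 0, C with: for
every prime p, elliptic W/F_p and u, the set D of affine points with x-coordinate (ZMod.val) in [u,
u + ⌊p^θ⌋) has additive energy E₂(D) = #{P₁+P₂ = P₃+P₄ in D⁴} ≤ C(p^{3θ−η} + p^{4θ−1}) — a power
saving over the trivial ≈ 8p^{3θ} (random value ≈ p^{4θ−1} + 2p^{2θ}): 'a short interval is not an
approximate subgroup of an elliptic curve'. E₂ = (1/N)Σ_χ |Σ_D χ|⁴, so θ > 1/2 follows from
completion + Kohel–Shparlinski; θ ≤ 1/2 is the Pólya–Vinogradov barrier for curves (no Burgess for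
cubic arguments) and exactly Semaev's small-coordinate regime (x(P_i) < p^{1/k}): large energy =
free relations for index calculus. Over F_p^* the analogous bound for intervals is proved by lifting
to ℤ — the move index calculus uses there and heights forbid on curves (Silverman), so the card's T2
and T3 meet here. k = 2 filed; k ≥ 3 is the planned split. -/
@[route_item "route-PneNP-EcdlpDefinability"]
def IntervalPointSetEnergy : Prop :=
  ∀ θ : ℝ, 0 < θ → θ < 1 → ∃ η C : ℝ, 0 < η ∧ ∀ (p : ℕ) [Fact p.Prime] (W : WeierstrassCurve (ZMod p)) [W.IsElliptic] (u : ℕ), ((Finset.univ.filter fun v : Fin 4 → ZMod p × ZMod p => (∀ i, ((v i).1).val ∈ Set.Ico u (u + ⌊(p : ℝ) ^ θ⌋₊)) ∧ ∃ h : ∀ i, W.toAffine.Nonsingular (v i).1 (v i).2, WeierstrassCurve.Affine.Point.some _ _ (h 0) + WeierstrassCurve.Affine.Point.some _ _ (h 1) = WeierstrassCurve.Affine.Point.some _ _ (h 2) + WeierstrassCurve.Affine.Point.some _ _ (h 3)).card : ℝ) ≤ C * ((p : ℝ) ^ (3 * θ - η) + (p : ℝ) ^ (4 * θ - 1))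

/-- item stmt-PneNP-2072 · support · rank 2 · open · by planner
why it might fail: Cannot fail mathematically for a fixed formula (CDM 1992 Main Thm); fails only if mis-typed (prime fields, parameters over F_p^n, m ≥ 0 — checked). The Lean proof needs Lang–Weil / RH for curves over finite fields, absent from Mathlib: a provability risk, not a truth risk.
sources: ChatzidakisVanDenDriesMacintyre1992 (Main Theorem; doi:10.1515/crll.1992.427.107), Kowalski2007 Cor. 13 with Thm 12 (arXiv:math/0504316 p.14, read), Literature.ModelTheory.PseudofiniteFields.ChatzidakisVanDenDriesMacintyre1992_mainTheorem (named fact, in tree), Literature.ModelTheory.PseudofiniteFields.ChatzidakisVanDenDriesMacintyre1992_mainTheorem.card_filter_le_or_le (PROVED in tree: CDM → exactly this item's statement), LangWeil1954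
[crux] FIRST crux = the unproved classical fact the line rests on (plancard rule): for every ring
formula φ(x̄; c̄) of FIXED complexity there are C, δ > 0 with |φ(F_p^m; c̄)| ≤ C or ≥ δ·p for all
primes p and all parameters c̄ — 'first-order logic cannot see a factor base' (index calculus needs
factor bases of size p^α, 0<α<1; bounded-complexity definable candidates, e.g. the algebraic factor
bases of Petit–Kosters–Messeng at bounded degree, have size O(1) or Ω(p)). Corollary of the
Chatzidakis–van den Dries–Macintyre Main Theorem (|φ(F_q^m;c̄)| = μ q^d + O(q^{d−1/2}), d ∈ ℕ,
finitely many (d, μ)). Known in print; filed as crux only because Literature/Mathlib lack CDM and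
Lang–Weil (FunctionFieldZeta.hasseWeil is a named fact; hasse_bound_holds is proved); a librarian
may land CDM as a named fact (cite item filed), after which this item is re-filed as support with
hypothesis (h : CDM). Audit scope correction honoured: complexity is O(1) (a fixed formula), never
p^{o(1)}. -/
@[route_item "route-PneNP-EcdlpDefinability"]
def DefinableSizeDichotomy : Prop :=
  ∀ (m n : ℕ) (φ : FirstOrder.Language.ring.Formula (Fin m ⊕ Fin n)), ∃ C δ : ℝ, 0 < δ ∧ ∀ (p : ℕ) [Fact p.Prime] (c : Fin n → ZMod p), (letI := FirstOrder.Ring.compatibleRingOfRing (ZMod p); (((Finset.univ.filter fun x : Fin m → ZMod p => φ.Realize (Sum.elim x c)).card : ℝ) ≤ C ∨ δ * (p : ℝ) ≤ ((Finset.univ.filter fun x : Fin m → ZMod p => φ.Realize (Sum.elim x c)).card : ℝ)))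

/-- item stmt-PneNP-2075 · support · rank 9 · closed · proved by Summit.PneNP.PneNP.Theorems.ecdlpDefinability_ecdlpInNP_proof @ c8250f11c52c (prover) · by planner
sources: CookClay2006 §1 (checking relations), Literature.Computability.Complexity.PNPWave0.NP, IsPolyTimeCheckingRelation (tree)
[support] Assembly glue: the same language is in Cook's NP over {0,1}: certificate = binary m ≤ t
(|m| ≤ |w|); the checking relation decodes the list (encodingListNatBool), tests primality of p
(AKS, Literature AKSMachineFP), reduces coefficients mod p, checks Δ ≠ 0 and nonsingularity of the
two points, computes m•P by double-and-add with Mathlib's addition law and compares with Q — all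
polynomial time. Routine mathematics, heavy TM2 bookkeeping (use the Literature FP/program toolkit
as in ShorModExpProgram, TardosFunctionFP). The Assembly item closes the moment this lands. -/
@[route_item "route-PneNP-EcdlpDefinability", crux]
def EcdlpInNP : Prop :=
  Literature.Computability.Complexity.encodingListNatBool.toLanguage {l : List ℕ | ∃ (p a₁ a₂ a₃ a₄ a₆ xp yp xq yq t : ℕ), l = [p, a₁, a₂, a₃, a₄, a₆, xp, yp, xq, yq, t] ∧ ∃ hp : p.Prime, (haveI : Fact p.Prime := ⟨hp⟩; ∃ (hP : (⟨(a₁ : ZMod p), (a₂ : ZMod p), (a₃ : ZMod p), (a₄ : ZMod p), (a₆ : ZMod p)⟩ : WeierstrassCurve (ZMod p)).toAffine.Nonsingular (xp : ZMod p) (yp : ZMod p)) (hQ : (⟨(a₁ : ZMod p), (a₂ : ZMod p), (a₃ : ZMod p), (a₄ : ZMod p), (a₆ : ZMod p)⟩ : WeierstrassCurve (ZMod p)).toAffine.Nonsingular (xq : ZMod p) (yq : ZMod p)), (⟨(a₁ : ZMod p), (a₂ : ZMod p), (a₃ : ZMod p), (a₄ : ZMod p), (a₆ : ZMod p)⟩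 : WeierstrassCurve (ZMod p)).Δ ≠ 0 ∧ ∃ m : ℕ, m ≤ t ∧ m • WeierstrassCurve.Affine.Point.some (xp : ZMod p) (yp : ZMod p) hP = WeierstrassCurve.Affine.Point.some (xq : ZMod p) (yq : ZMod p) hQ)} ∈ Literature.Computability.Complexity.PNPWave0.NP Bool

/-- item stmt-PneNP-2076 · support · rank 9 · closed · proved by Summit.PneNP.PneNP.Theorems.ecdlpDefinability_polynomialLogDegreeBound_proof @ a1a65046c602 (prover) · by planner
sources: LangeWinterhof2002 (doi:10.1007/3-540-45655-4_16), theorem on polynomial interpolation of the EC discrete log (exact numbering pending acq-02105), Mathlib AlgebraicGeometry.EllipticCurve.DivisionPolynomial.Basic / Affine.Formula (x-coordinate of 2P)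
[support] The elementary base rung (Lange–Winterhof type), Lean-feasible now: for an elliptic W/F_p,
a point P of order N and any F ∈ F_p[X], the number of t with 0 < t, 2t < N such that F(x(tP)) = t̄
and F(x(2tP)) = 2t̄ is ≤ 4·deg F + 2. Proof to adapt: x(2R) = r(x(R)) with r = φ₂/ψ₂² a rational
function of degree 4 having poles at the 2-torsion abscissae (nonsingularity), so for nonconstant F
the rational function F∘r − 2F is nonzero (it has poles; in characteristic 2 with a₁ = 0 it is F∘r
of degree 4 deg F) and, after clearing denominators, has ≤ 4 deg F roots; the abscissae x(tP), 0 < t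
< N/2, are pairwise distinct and are roots (2tP ≠ O so ψ₂²(x(tP)) ≠ 0); constant F gives ≤ 1
solution since t ≡ 0 mod p is impossible for 0 < t < N/2 ≤ (p+1+2√p)/2 (p ≥ 3; p = 2 checked by N ≤
5). Corollary: a polynomial agreeing with the logarithm on all of (0, N/2) has degree ≥ N/16 − 1.
Mathlib: WeierstrassCurve.Affine addition formulas, DivisionPolynomial (ψ₂, Φ₂), hasse_bound_holds
if N vs p is needed. -/
@[route_item "route-PneNP-EcdlpDefinability"]
def PolynomialLogDegreeBound : Prop :=
  ∀ (p : ℕ) [Fact p.Prime] (W : WeierstrassCurve (ZMod p)) [W.IsElliptic] (P : W.toAffine.Point) (F : Polynomial (ZMod p)), ((Finset.range (addOrderOf P)).filter fun t : ℕ => 0 < t ∧ 2 * t < addOrderOf P ∧ (∃ (x y : ZMod p) (h : W.toAffine.Nonsingular x y), t • P = WeierstrassCurve.Affine.Point.some x y h ∧ F.eval x = (t : ZMod p)) ∧ (∃ (x y : ZMod p) (h : W.toAffine.Nonsingular x y), (2 * t) • P = WeierstrassCurve.Affine.Point.some x y h ∧ F.eval x = ((2 * t : ℕ) : ZMod p))).card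 ≤ 4 * F.natDegree + 2

/-- item stmt-PneNP-2077 · support · rank 9 · closed · proved by Summit.PneNP.PneNP.Theorems.ecdlp_legendreFingerprint_proof @ 5a940218e2e1 (prover) · by planner
sources: BlumMicali1984 §3 (hard-core predicates of the discrete log: predicate oracles give the log), BonehLipton1996 (doi:10.1007/3-540-68697-5_22: black-box fields over F_p), MaurerRaub2007 (doi:10.1007/978-3-540-76900-2_26), Shoup1997; MaurerWolf1998; CorriganGibbsKogan2018 (the generic/aux-input bounds this observation delimits)
[support] Typed record of the dead end that reshaped the card: for u ≠ u' in F_p, #{c : (u+c is a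
square) ↔ (u'+c is a square)} ≤ p/2 + 2 (0 counts as a square; from Σ_c η((c+u)(c+u')) = −1, Mathlib
quadraticChar sums or the tree's Stepanov/Weil lemma at degree 2). Consequence (informal, union
bound over independent uniform shifts): 3·log₂ p queries of the single bounded formula ∃z (z·z = x +
c) identify the x-coordinate of a HIDDEN point with probability ≥ 1 − 1/p using no group operations,
so every information-theoretic 'generic group + bounded-complexity definable decision oracle with
parameters' model — the card's original T1 genericity theorem, Shoup + definable oracles — has query
complexity O(log p), not Ω(√p); likewise black-box-field models over a known prime (Boneh–Lipton
1996, Maurer–Raub 2007). This is why the route files definability bounds for the log FUNCTION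
(DefinableLogBound) instead of oracle-genericity, and no Capture item. -/
@[route_item "route-PneNP-EcdlpDefinability"]
def LegendreFingerprint : Prop :=
  ∀ (p : ℕ) [Fact p.Prime] (u u' : ZMod p), u ≠ u' → (Finset.univ.filter fun c : ZMod p => (IsSquare (u + c) ↔ IsSquare (u' + c))).card ≤ p / 2 + 2

/-- item stmt-PneNP-2078 · assembly · rank 1 · closed · proved by Summit.PneNP.PneNP.Theorems.ecdlpDefinability_assembly_proof @ c93395da820c (prover) · by planner
sources: CookClay2006 §1
[assembly] EcdlpInNP → EcdlpNotInP → PneNP: PneNP = Literature.PNP.PNeNP = ∃ L, L ∈ PNPWave0.NP Bool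
∧ L ∉ PNPWave0.P Bool, so the proof is `fun hNP hP => ⟨_, hNP, hP⟩` (checked in the planner's
Sketch.lean, axioms propext/choice/Quot.sound). The cruxes are rungs of the restricted-model ladder
under the target and are glued to X only through the (unfiled, target-equivalent) uniform capture
statement — crux statements first, glue later (D-0019). -/
@[route_item "route-PneNP-EcdlpDefinability"]
def Assembly : Prop :=
  EcdlpInNP → EcdlpNotInP → PneNP

/-! D-0027 §2.1 — DECIDING THEOREM (planner-authored via `route open/edit --closes-file`; by planner-rbadge-PneNP-EcdlpDefinability-eec1868d-g2-0 2026-08-15T16:16:29Z):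
its hypotheses are this route's items and its conclusion the sub-problem Statement (glue_lint), and it elaborates with this file. -/

@[closes "route-PneNP-EcdlpDefinability"] theorem closes (hNP : EcdlpInNP) (hP : EcdlpNotInP) : _root_.PneNP :=
  ⟨_, hNP, hP⟩

end Summit.PneNP.PneNP.Theses.EcdlpDefinability
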